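import Literature.MathematicalPhysics.QuantumFieldTheory.Balaban1983to89.B2Eq265BoxMargins
import Literature.MathematicalPhysics.QuantumFieldTheory.Balaban1983to89.B2Lemma23From255

/-!
# `Balaban1983to89.B2Eq265From255` — [Balaban1982Higgs2] **Lemma 2.4 (2.65) p.572, VALUE CLAUSE, ON THE (Higgs)₂,₃ CARRIER OF RECORD,
# «UNDER THE RESTRICTIONS (2.55)» IN FULL**: the typer's `B2Eq255Concrete.Restr255` now feeds ALL FOUR printed conjuncts — (2.55)₃,₄ on
# `φ` as in F9 (p.573 «Now let us consider the restrictions (2.55) on the field φ …») AND (2.55)₁,₂ on the step's vector field `A′` through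
# Lemma 2.3 (2.60) for the cut-off minimizer `A^{(k)} = a_kζ^{(k)}G_kQ_k^*A′` (p.572 «From the property (2.60) we have the inequality
# |A^{(k)}(x) − A^{(k)}(y)| ≦ O(p(Lᵏε)r(Lᵏε)).», own `B2Lemma23From255.lemma23_restr255`); the positional hypotheses in print's form (F11)
# (`eq265_higgs_region_from255`)

statement-level skeleton of published theorems with citation tags; proofs where landed; nothing here is a claim
about the Yang–Mills mass gap

PDF held: `paper:balaban1982-cmp86-higgs23-ii` (journal page = PDF page + 554), p. 572 [PDF 18] (Lemma 2.4 L1–4, L6–8, L12–14), p. 571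
[PDF 17] (Lemma 2.3), p. 570 [PDF 16] ((2.55)), p. 558 [PDF 4] ((2.7)/(2.8)).

CITATION HEADER (lean-in-tree rule).  T. Bałaban, *(Higgs)₂,₃ quantum fields in a finite volume. II. An upper bound*,
Commun. Math. Phys. **86** (1982) 555–594, doi:10.1007/bf01214890 [Balaban1982Higgs2].  Cell `lit-balaban` (HOME
`run/shared/lean/pub/lit-balaban/`), Phase-2 proof seat **p23** gen 22 (unit `lit-balaban-p23-g22`; free-target protocol G.5-34(d), TAKING #5
line HOME/STATUS.md 2026-08-23); SKELETON row **B2.Lem2.4** (fold owner r02, second reader r14; head `proved p250408 · …` UNCHANGED —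
cells-only member, brick F12 of the seat's programme).  USED BY NAME, never restated: own F9 `B2Eq265Restrictions255.eq265_higgs_region_restr255`,
own F10 `B2Eq265From260.grad_ofSite_cutMin_le`, own F11 `B2Eq265BoxMargins.{box_subset_of_margin, two_mul_side_le_of_margin,
mem_underRegion_of_tdist_le}`, own `B2Lemma23From255.lemma23_restr255` (row B2.Lem2.3; r14's `B2Lemma23HiggsLattice` underneath), r14's
`B1Ineq234Concrete.tdist_self`, the typer's `B2Eq255Concrete.{Restr255, bgScalar256, underRegion}`, `B3MultiscaleFields.{toSite, ofSite}`.

THE ARGUMENT.  F11 = (2.65) for `A^{(k)} := ofSite (cutMin C₀ μ₀² a_V k ζ (toSite A′))` under Lemma 2.3's INTEGRATED hypotheses on `A′`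
(`t_V`, `q_V(r₁ + r₂|y − y′|)` on `Λ₋₁`).  Own `lemma23_restr255` gives (2.60) for that minimizer from (2.55)₁,₂ AS PRINTED (per-bond
`|(∂A′)(b)| ≤ c₁pℓ`, sup `|A′(x)| ≤ c₁·t_A·pℓ` on `Λ₋₁`) once the cube of radius `R_n ≥ ρ + 1` about every `y ∈ Λ₂` lies in `Λ₋₁`, with the
bound `L^{−k}(C_V·d·(Lᵏε)c₁pℓ + C_F e^{−δρ₁}c₁t_Apℓ)`; so the chain F9 (t′, λ_A from conjuncts 3–4) ∘ [gradient hypothesis from conjuncts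
1–2, point by point] ∘ F11's geometry gives (2.65) under ONE hypothesis `Restr255 C c₁ pℓ t_A tPhi k Λ₋₁ A′ φ A^{(k)}` on the fields, the
(2.44) data of `ζ^{(k)}`, the (2.8)-type cube condition, the box geometry read as in print, and the two printed smallness scalings of `δA`.

WHAT THIS FILE PROVES (kernel-checked, zero `sorry`; theorems only — NO definition, NO `Prop`-valued fact; axioms standard).
 **`eq265_higgs_region_from255`** — F11's `B2Eq265BoxMargins.eq265_higgs_region_margins` word for word except (located edits): in Lemma 2.3's
 data block the hypothesis `Λ₂ ⊆ Λ₋₁` is DROPPED (derived from the cube condition), the `(ρ+1)`-neighbourhood condition is REPLACED by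
 `(R_n : ℕ), ρ + 1 ≤ R_n → 2(2R_n+1) ≤ |T^{(k)}|_μ → (∀ y ∈ Λ₂, ∀ y′, |y − y′| ≤ R_n → y′ ∈ Λ₋₁) →`, the binders `t_V q_V r₁ r₂` with their
 signs and the two integrated hypotheses on `toSite A′` are DROPPED, the letters `{c₁ pℓ t_A tPhi}` with `0 ≤ c₁, 0 ≤ pℓ, 0 ≤ tPhi` MOVE from
 the `φ`-block to right after `A′`, and `δA`'s lower bound reads `L^{−k}(C_V·d·((Lᵏε)(c₁pℓ)) + C_F e^{−δρ₁}(c₁t_Apℓ)) ≤ δA`; the `φ`-block is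
 `∀ φ, Restr255 C c₁ pℓ t_A tPhi k Λ₋₁ A′ φ (ofSite (cutMin …)) →`.  The seven-term bound is F9's = F10's = F11's, character for character.

HONEST SCOPE / DIFFERENCES FROM PRINT (recorded, not hidden; one sentence each).  (a) What is a HYPOTHESIS of this (2.65): the typer's
(2.55) predicate with free letters `c₁, pℓ, t_A, tPhi` (printed instance `Restr255Printed`) on a coarse region `Λ₋₁ ⊇ Λ₆`; the cutoff data
`ζ, ρ, ρ₁` with the four printed (2.44) properties; the cube condition (radius `R_n ≥ ρ + 1`, `2(2R_n+1) ≤ |T^{(k)}|_μ`) — a reading of (2.8)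
«Λ₋₁ ⊇ the r(Lᵏε)-collar of Λ₂»; the box geometry of F11 (`□₂ = q + [0,S)ᵈ` a cell-box carrier, margin `m ≥ R₁` of `x_k`, `□₁ ⊆ Λ₆ ⊆ Λ₂ ⊇ □₂`,
`Bᵏ(Λ₂)` a big-block union, `2r_S + 2half(d+1) + 1 ≤ Lᵏm`); the torus sub-family `Shape P`, odd `L > 1`, `K₀ ∣ M`, `1 ≤ k ≤ K`, `Lᵏε ≤
min(ε₀,1)`; the two smallness scalings `LᵏδA|e| ≤ t`, `Lᵏ(Lᵏε)|e|δA ≤ c_reg e_k^β` on any `δA ≥` the (2.60) bound — print's «for e(Lᵏε)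
sufficiently small».  (b) What is READ, not derived: the letters against print (`pℓ ⇐ p(L^{k−1}ε)`, `t_A ⇐ 1/(μ₀L^{k−1}ε)`, `tPhi ⇐ λ^{−1/4}`,
`S ⇐ 4r`, `R₁ ≤ m ⇐ 2r`, `R_n, ρ, ρ₁ ⇐ (2.7)/(2.44)`), and the final `O(p(Lᵏε))` SIZE of the seven terms (via `rDecayBeatsPowers`, rows
B2.Lem2.3/2.4) — the bound stays explicit.  (c) Everything else as in F11's/F10's HONEST SCOPE (value clause only — (2.66)/(2.77) not here;
zero external field in (2.54); base point the corner; granularity of `□₁`, `□₂` vs print's sums of large blocks; constants' provenance — none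
minted here: `δ, C_V, C_F` are Lemma 2.3's, `K₀min, e₁, t, C₁ … D₄` F9's).  NOT summit progress.
-/

open scoped BigOperators

noncomputable section

namespace Literature.MathematicalPhysics.QuantumFieldTheory.Balaban1983to89.B2Eq265From255

open HiggsLattice (ChargeData)
open HiggsAveraging (blockIter toFinest)
open HiggsCovariance (avgQkAdj)
open B2Eq255Concrete (bgScalar256 underRegion mem_underRegion Restr255)
open B2Eq265Restrictions255 (eq265_higgs_region_restr255)
open B2Eq265From260 (grad_ofSite_cutMin_le)
open B2Eq265BoxMargins (box_subset_of_margin two_mul_side_le_of_margin mem_underRegion_of_tdist_le)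
open B2Lemma23From255 (lemma23_restr255)
open B2Lemma23HiggsLattice (cutMin)
open B1Eq211ZeroFieldTorus (Shape)
open B3MultiscaleFields (toSite ofSite)
open B1Ineq225RegularBox (cellBox)
open B1Ineq234Concrete (distC tdist_self)
open B1TorusRegionHSizes (IsBigBlockUnion)
open B1TorusCubeCover (half)
open B1TorusCubeLocality26 (rS)

variable {P : HiggsLattice.Params} {k : ℕ}

/-! ## (2.65) under the restrictions (2.55), all four conjuncts by name -/

section Eq265From255

/-- **LEMMA 2.4 (2.65), VALUE CLAUSE, ON THE (Higgs)₂,₃ CARRIER — «Under the restrictions (2.55)», all four conjuncts; «x ∈ Bᵏ(y)».**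
TYPED vs PRINTED: this is F11's `B2Eq265BoxMargins.eq265_higgs_region_margins` word for word except the located edits in Lemma 2.3's data
block — `Λ₂ ⊆ Λ₋₁` dropped (derived); the `(ρ+1)`-neighbourhood condition ↦ `(R_n : ℕ), ρ + 1 ≤ R_n → 2(2R_n+1) ≤ |T^{(k)}|_μ → (∀ y ∈ Λ₂,
∀ y′, |y − y′| ≤ R_n → y′ ∈ Λ₋₁) →`; the binders `t_V q_V r₁ r₂`, their signs and the two integrated hypotheses on `toSite A′` dropped; the
letters `{c₁ pℓ t_A tPhi}` with `0 ≤ c₁`, `0 ≤ pℓ`, `0 ≤ tPhi` moved from the `φ`-block to after `A′`; `δA`'s lower bound ↦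
`L^{−k}(C_V·d·((Lᵏε)(c₁pℓ)) + C_F e^{−δρ₁}(c₁t_Apℓ))`; the `φ`-block ↦ `∀ φ, Restr255 C c₁ pℓ t_A tPhi k Λ₋₁ A′ φ (ofSite (cutMin …)) →`.
The bound is F11's, character for character. [cite: Balaban1982Higgs2, Lemma 2.4 (2.65) p.572]
[cite: Balaban1982Higgs2, (2.55) p.570, Lemma 2.3 (2.60) p.571]
[cite: Balaban1982Higgs2, Lemma 2.4 proof p.572 «From the property (2.60) we have the inequality |A^{(k)}(x) − A^{(k)}(y)| ≦ O(p(Lᵏε)r(Lᵏε)).»] -/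
theorem eq265_higgs_region_from255 (d L : ℕ) (hd : 1 ≤ d) (hL : Odd L ∧ 1 < L) {a : ℝ} (ha : 0 < a) {msq : ℝ} (hmsq : 0 < msq)
    {aV : ℝ} (haV : 0 < aV) {mu0sq : ℝ} (hmu0 : 0 < mu0sq)
    (N : ℕ) (C : ChargeData N) (ε₀ : ℝ) (creg β : ℝ) (hcreg : 0 ≤ creg) (hβ : 0 < β) :
    ∃ δ CV CF : ℝ, 0 < δ ∧ 0 < CV ∧ 0 < CF ∧
    ∃ K₀min : ℕ, ∀ K₀ : ℕ, K₀min ≤ K₀ → ∃ e₁ t : ℝ, 0 < e₁ ∧ 0 < t ∧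
      ∃ C₁ C₂ C₃ D₁ D₂ D₃ D₄ : ℝ, 0 ≤ C₁ ∧ 0 ≤ C₂ ∧ 0 ≤ C₃ ∧ 0 ≤ D₁ ∧ 0 ≤ D₂ ∧ 0 ≤ D₃ ∧ 0 ≤ D₄ ∧
      ∀ (P : HiggsLattice.Params) (_ : Shape P), P.d = d → P.L = L → K₀ ∣ P.M →
      ∀ {k : ℕ}, 1 ≤ k → k ≤ P.K → (∀ μ, 3 * half P k K₀ ≤ P.sitesPerDir 0 μ) → P.mesh k ≤ ε₀ → P.mesh k ≤ 1 →
      ∀ (Λ₂ Λ₆ sq₂ sq₁ : Finset (HiggsLattice.Site P k)) (S : Fin P.d → Finset ℕ) (q : HiggsLattice.Site P k) (Sbox : ℕ),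
        Λ₆ ⊆ Λ₂ → sq₂ ⊆ Λ₂ → sq₁ ⊆ Λ₆ →
        IsBigBlockUnion k K₀ (underRegion k Λ₂) → underRegion k sq₂ = cellBox k K₀ S →
        (∀ μ : Fin P.d, P.L ^ k * Sbox < P.sitesPerDir 0 μ) →
      -- `□₂` IS the box `q + [0,S)ᵈ` of coarse sites, `□ = B^k(□₂)` smaller than half the torus
        (∀ y : HiggsLattice.Site P k, y ∈ sq₂ ↔ ∀ ν : Fin P.d, (y ν - q ν).val < Sbox) →
        (∀ μ : Fin P.d, 2 * (P.L ^ k * Sbox) ≤ P.sitesPerDir 0 μ) →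
      -- `□₁` is the box of coarse sites of radius `R₁` (corner `q₁`); `m ≥ R₁` a coarse margin with `Lᵏm ≥` the depth radius
      ∀ (q₁ : HiggsLattice.Site P k) (R₁ m : ℕ), R₁ ≤ m → 2 * rS P k K₀ + 2 * half P k K₀ * (P.d + 1) + 1 ≤ P.L ^ k * m →
        (∀ y : HiggsLattice.Site P k, y ∈ sq₁ ↔ ∀ ν : Fin P.d, (y ν - q₁ ν).val < 2 * R₁ + 1) →
      -- the region `Λ₋₁` of (2.55); the cutoff `ζ^{(k)}` of (2.44); the cube of radius `R_n ≥ ρ + 1` about every `y ∈ Λ₂` inside `Λ₋₁` ((2.8))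
      ∀ (Λm1 : Finset (HiggsLattice.Site P k))
        (ζ : HiggsLattice.Site P 0 → HiggsLattice.Site P k → ℝ) (ρ ρ₁ : ℝ), 0 ≤ ρ₁ →
        (∀ x y', |ζ x y'| ≤ 1) →
        (∀ x y', ζ x y' ≠ 0 → (HiggsLattice.Site.tdist (blockIter k x) y' : ℝ) ≤ ρ) →
        (∀ x y', (HiggsLattice.Site.tdist (blockIter k x) y' : ℝ) ≤ ρ₁ → ζ x y' = 1) →
        (∀ (x : HiggsLattice.Site P 0) (ν : Fin P.d) (y' : HiggsLattice.Site P k), |ζ (x.shift ν) y' - ζ x y'| ≤ ((P.L : ℝ) ^ k)⁻¹) →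
      ∀ (Rn : ℕ), ρ + 1 ≤ (Rn : ℝ) → (∀ μ : Fin P.d, 2 * (2 * Rn + 1) ≤ P.sitesPerDir k μ) →
        (∀ y ∈ Λ₂, ∀ y' : HiggsLattice.Site P k, HiggsLattice.Site.tdist y y' ≤ Rn → y' ∈ Λm1) →
      -- a charge datum on `ℝ^d`, the step's vector field `A′`, and the letters of (2.55)
      ∀ (C₀ : ChargeData P.d) (A' : HiggsLattice.VecField P k) {c₁ pℓ tA tPhi : ℝ}, 0 ≤ c₁ → 0 ≤ pℓ → 0 ≤ tPhi →
      -- `δA` is at least the (2.60) bound read off (2.55)₁,₂, and small in the two printed scalings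
      ∀ {δA : ℝ}, ((P.L : ℝ) ^ k)⁻¹ * (CV * P.d * (P.mesh k * (c₁ * pℓ)) + CF * Real.exp (-(δ * ρ₁)) * (c₁ * tA * pℓ)) ≤ δA →
          (P.L : ℝ) ^ k * δA * |C.e| ≤ t →
        ∀ {ec : ℝ}, 0 < ec → ec ≤ e₁ → (P.L : ℝ) ^ k * P.mesh k * |C.e| * δA ≤ creg * ec ^ β →
      -- `x ∈ Bᵏ(ȳ)` with `ȳ` the centre of `□₁` and at least `m` inside `□₂` in every direction
      ∀ (x : HiggsLattice.Site P 0),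
        (∀ ν : Fin P.d, m ≤ ((blockIter k x) ν - q ν).val ∧ ((blockIter k x) ν - q ν).val + m < Sbox) →
        (∀ ν : Fin P.d, ((blockIter k x) ν - q₁ ν).val = R₁) →
      -- THE RESTRICTIONS (2.55) on `Λ₋₁` for the fields `A′, φ` of the step and the background `A^{(k)} = a_kζ^{(k)}G_kQ_k^*A′` — all four conjuncts used
      ∀ (φ : HiggsLattice.ScalarField P k N),
        Restr255 C c₁ pℓ tA tPhi k Λm1 A' φ (ofSite (cutMin C₀ mu0sq aV k ζ (toSite A'))) →
        ‖bgScalar256 C msq a k Λ₂ Λ₆ (ofSite (cutMin C₀ mu0sq aV k ζ (toSite A'))) φ x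
            - avgQkAdj C (ofSite (cutMin C₀ mu0sq aV k ζ (toSite A'))) k φ x‖
          ≤ B1.aSeq a P.L k * (c₁ * tPhi * pℓ) *
                (C₁ * Real.exp (-(1 / (4 * K₀) * (distC (underRegion k sq₂) x / (P.L : ℝ) ^ k)))
                  + C₂ * Real.exp (-(1 / (4 * K₀) * ((R₁ : ℝ) + 1))))
            + (D₁ * P.mesh k ^ 2 *
                (B1.aSeq a P.L k * (P.mesh k)⁻¹ ^ 2 * (|C.e| * (δA * (P.d * ((P.L : ℝ) ^ k * Sbox))) * P.mesh 0 * (P.d * ((P.L : ℝ) ^ k - 1))) * (c₁ * tPhi * pℓ)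
                  + |C.e| * (δA * (P.d * ((P.L : ℝ) ^ k * Sbox))) * (P.d * ((B1.aSeq a P.L k * (P.mesh k)⁻¹ ^ 2 * (c₁ * tPhi * pℓ) * D₄ * P.mesh k
                        + |C.e| * (δA * (P.d * ((P.L : ℝ) ^ k * Sbox))) * (B1.aSeq a P.L k * D₃ * (c₁ * tPhi * pℓ))) + |C.e| * (δA * (P.d * ((P.L : ℝ) ^ k * Sbox))) * (B1.aSeq a P.L k * D₃ * (c₁ * tPhi * pℓ))))
                  + B1.aSeq a P.L k * (P.mesh k)⁻¹ ^ 2 *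
                      ((2 * (|C.e| * (δA * (P.d * ((P.L : ℝ) ^ k * Sbox))) * P.mesh 0 * (P.d * ((P.L : ℝ) ^ k - 1)))
                        + (|C.e| * (δA * (P.d * ((P.L : ℝ) ^ k * Sbox))) * P.mesh 0 * (P.d * ((P.L : ℝ) ^ k - 1))) ^ 2) * (B1.aSeq a P.L k * D₃ * (c₁ * tPhi * pℓ))))
              + D₂ * P.mesh k * (|C.e| * (δA * (P.d * ((P.L : ℝ) ^ k * Sbox))) * (B1.aSeq a P.L k * D₃ * (c₁ * tPhi * pℓ))))
            + B1.aSeq a P.L k * C₃ *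
                (4 * K₀ * ((P.mesh k * (c₁ * pℓ) + P.mesh k * |C.e| * (δA * (P.d * ((P.L : ℝ) ^ k * Sbox))) * (c₁ * tPhi * pℓ)) * P.d)
                  + Real.exp (-(1 / (4 * K₀) * ((R₁ : ℝ) + 1))) * (c₁ * tPhi * pℓ))
            + msq * P.mesh k ^ 2 / (B1.aSeq a P.L k + msq * P.mesh k ^ 2) * (c₁ * tPhi * pℓ)
            + |C.e| * P.mesh 0 * (P.d * ((P.L : ℝ) ^ k - 1)) * (δA * (P.d * ((P.L : ℝ) ^ k * Sbox))) * (c₁ * tPhi * pℓ) := by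
  -- Lemma 2.3's constants under (2.55)₁,₂ (own `B2Lemma23From255`), then F9's
  obtain ⟨δ, CV, CF, hδ, hCV, hCF, h23⟩ := lemma23_restr255 d L hd hL haV hmu0 ε₀
  have hL2 : 2 ≤ L := by omega
  obtain ⟨K₀min, h⟩ := eq265_higgs_region_restr255 d L hd hL2 ha hmsq N C ε₀ creg β hcreg hβ
  refine ⟨δ, CV, CF, hδ, hCV, hCF, K₀min, fun K₀ hK₀ => ?_⟩
  obtain ⟨e₁, t, he₁, ht, C₁, C₂, C₃, D₁, D₂, D₃, D₄, hC₁, hC₂, hC₃, hD₁, hD₂, hD₃, hD₄, h⟩ := h K₀ hK₀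
  refine ⟨e₁, t, he₁, ht, C₁, C₂, C₃, D₁, D₂, D₃, D₄, hC₁, hC₂, hC₃, hD₁, hD₂, hD₃, hD₄, ?_⟩
  intro P S hPd hPL hK₀M k hk1 hkK h3 hε h1 Λ₂ Λ₆ sq₂ sq₁ Sfin q Sbox h62 hs2 h16 hΩΛ hbox hSbox hsq₂ h2S q₁ R₁ m hR₁m hRm hsq₁
    Λm1 ζ ρ ρ₁ hρ₁ zeta_abs zeta_supp zeta_one zeta_lip Rn hRn hRn2 hcube C₀ A' c₁ pℓ tA tPhi hc₁ hpℓ htPhi δA h60δ ht' ec hec hle hsmall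
    x hmargin hcentre φ h255
  -- F11's geometry, by name
  have h12 : sq₁ ⊆ sq₂ := box_subset_of_margin hkK q Sbox sq₂ sq₁ hsq₂ hSbox q₁ (blockIter k x) R₁ m hR₁m hsq₁ hcentre hmargin
  have hS₁ : ∀ μ : Fin P.d, 2 * (2 * R₁ + 1) ≤ P.sitesPerDir k μ :=
    two_mul_side_le_of_margin hkK h2S q (blockIter k x) R₁ m hR₁m hmargin
  have hx : ∀ z, HiggsLattice.Site.tdist x z ≤ 2 * rS P k K₀ + 2 * half P k K₀ * (P.d + 1) + 1 → z ∈ underRegion k sq₂ :=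
    fun z hz => mem_underRegion_of_tdist_le hkK q Sbox sq₂ hsq₂ h2S x m _ hRm hmargin hz
  -- `Λ₂ ⊆ Λ₋₁` from the cube condition
  have h2m1 : Λ₂ ⊆ Λm1 := fun y hy => hcube y hy y (by rw [tdist_self]; exact Nat.zero_le _)
  -- (2.60) under (2.55)₁,₂ for the cut-off minimizer, point by point, BY NAME
  have hgrad : ∀ z ∈ underRegion k Λ₂, ∀ μ ν : Fin P.d,
      |ofSite (cutMin C₀ mu0sq aV k ζ (toSite A')) ⟨z.shift ν, μ⟩ - ofSite (cutMin C₀ mu0sq aV k ζ (toSite A')) ⟨z, μ⟩| ≤ δA := by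
    subst hPd
    refine grad_ofSite_cutMin_le C₀ mu0sq aV k ζ (toSite A') Λ₂ h60δ ?_
    intro z hz ν
    exact (h23 P S rfl hPL C₀ hk1 hkK hε ζ ρ ρ₁ hρ₁ zeta_abs zeta_supp zeta_one zeta_lip Λm1 Λ₂ Rn hRn hRn2 hcube C A' φ _ hc₁ hpℓ
      h255 z hz).2 ν
  have hδA : 0 ≤ δA := by
    refine le_trans ?_ h60δ
    have h1 : 0 ≤ CV * P.d * (P.mesh k * (c₁ * pℓ)) := by
      have := (P.mesh_pos k).le
      positivity
    have h2 : 0 ≤ CF * Real.exp (-(δ * ρ₁)) * (c₁ * tA * pℓ) := by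
      -- `c₁·t_A·pℓ ≥ ‖A′(x_k)‖ ≥ 0` (conjunct 2 at the point `x_k ∈ Λ₂ ⊆ Λ₋₁`)
      have hxΛ : blockIter k x ∈ Λ₂ := hs2 ((mem_underRegion k sq₂ x).mp (hx x (by rw [tdist_self]; exact Nat.zero_le _)))
      have ht0 : 0 ≤ c₁ * tA * pℓ := (norm_nonneg _).trans (h255.2.1 _ (h2m1 hxΛ))
      positivity
    exact mul_nonneg (inv_nonneg.mpr (pow_nonneg (Nat.cast_nonneg _) k)) (add_nonneg h1 h2)
  exact h P hPd hPL hK₀M hk1 hkK h3 hε h1 Λ₂ Λ₆ sq₂ sq₁ Sfin q Sbox h62 hs2 h12 h16 hΩΛ hbox hSbox hsq₂ h2S q₁ R₁ hS₁ hsq₁ _ hδA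
    hgrad ht' hec hle hsmall x hx hcentre φ Λm1 A' hc₁ hpℓ htPhi (h62.trans h2m1) h255

end Eq265From255

end Literature.MathematicalPhysics.QuantumFieldTheory.Balaban1983to89.B2Eq265From255

end
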